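import Summits.QuantumFields.YangMills.Theorems.BalabanUVNodesN08AtRecord13LaneFamily
import Summits.QuantumFields.YangMills.Theorems.BalabanUVNodesN08AlphaProfile

/-!
# BalabanUVNodes ∕ N08 AT THE LANE-RE-BOUND STAGE-13 RECORD FROM REGULAR `h`-LARGE PROFILES (b11‴) — dag-n08-d's packaged (α) END forms
# (`BalabanUVNodesN08AlphaProfile`, g4 file 12) composed BY NAME into this seat's `BalabanUVNodesN08AtRecord13LaneFamily` (Track A, DAG node N08
# [Balaban1985UV3] CMP **102** (1985) 255, Thm 1 p. 257 (compact reading) + Thm 2 p. 272; R134 fan-out seat `pub-ymgap-dag-n08-c` g8, strategy s2 «knit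
# `B10Assembly` (`Thm1PrintedCompact ∧ Thm2Printed`) at the record of record by name», 2026-08-27)

WHY THIS FILE.  `BalabanUVNodesN08AtRecord13LaneFamily` §3 presents N08's conjunct of K1‴'s Stage-13 nodes-∃ at a ₁₃C record whose [B10] layer is RE-BOUND to the
d = 3 lane's constructed tower-run family `S ↦ towerOf 𝔠.lane (X S) (𝔖 S)` on the N08 window `ScalesLE θ.L ((min γ_N08 1)²)`, from two displayed hypothesis families:
the cluster-expansion DATA schema `RunDataRows` (at the concrete sizes) and the THREE IN-EDGE FACES `InEdgeFaces₃ 𝔊 (regMin 𝔠) (X S)` about GIVEN external inputs `X S`.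
dag-n08-d's g4 chain (`…AlphaGroupTopology`, `…AlphaRegSel`, `…AlphaInB42Sel`, `…AlphaCompactSel`, `…AlphaArgClass`, `…AlphaAdaptedSel`, `…AlphaAdaptedEnd`, and its file 12 `…AlphaProfile`)
PROVES the three faces for minimiser-SELECTED external inputs: per lattice approximation `S`, from base inputs `X₀` (averaging ∕ regularity), a continuous objective `A`, top maps `T k`
continuous on [7]'s regular class, bond sets `Bk`, and ONE displayed kinematic sentence (b11‴) «every admissible history `h` of every step `k ≤ K` is exhibited by a
configuration `W k h` of the adapted closed regular class (`regClassC ∩ argClassC`) whose lifted `j`-fold averages are `h`-LARGE», external inputs `X` EXIST with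
`X.av = X₀.av`, `X.reg = X₀.reg`, every `X.UkH k h` measurable and `InEdgeFaces₃ 𝔊 𝔠 X` (`exists_externalInputs_faces₃_of_profile`); with the standard averaging, a Wilson
action as objective and the iterated standard averaging on top, `RunAlpha 𝔊 𝔠 X 𝔖 𝔄` follows from the DATA schema on the N08 window (`exists_externalInputs_runAlpha_of_profile`).
Neither END form had a consumer in the tree.  HERE they are composed into the ₁₃C record: uniformly in `S : Scales θ.L` the external inputs are SELECTED (§1, axiom of
choice over the lattice approximations; off the N08 window the witness is `X₀ S` itself, the statements recording only the agreement on `av ∕ reg`), so that N08's conjunct of the ₁₃ nodes-∃ — and the pointed world over the lane-re-bound Stage-13 view —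
follow from `θ`'s provisos ∕ admissibility ∕ guard, the profiles (b11‴) and the kinematic choices on the N08 window, and the DATA schema AT THE SELECTED INPUTS (§2: objective
and top maps free; §3: standard averaging, Wilson action, no `A ∕ T ∕ hT`), the three in-edge faces being THEOREMS of dag-n08-d's chain and no longer hypotheses; §4 reads
§2∕§3 on K0a's all-numerics witness family `θL F n ε₂₉ = theta13LiveOfNumerics F 2 n ε₂₉ …` (block size `F.L` by `rfl`), provisos taken OPAQUELY as `hP : θL.Provisos₁₃ F 2`
(no row-P11 socket text is restated here: director-ym №136–№138 re-type `Provisos₁₃.bg`'s range under a NEW proviso name, rev 18; an opaque `hP` re-keys by the token map).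

THE SHAPE OF THE CONCLUSIONS (read this first).  The selected inputs are EXISTENTIAL (measurable minimisers chosen inside dag-n08-d's proof), so every END theorem reads
`∃ X : ∀ S, ExternalInputs S G, (agreement with X₀ on av ∕ reg) ∧ (on the N08 window: measurability ∧ InEdgeFaces₃) ∧ ∀ 𝔖 𝔄 coef, DATA(X) → …` — DATA is demanded AT THE
SELECTED INPUTS inside the ∃ (dag-n08-d's own END shape); a consumer discharges it only by a supplier uniform in `X.UkH` ((41)∕(47) = dag-n08-b's class II object gap, unchanged).

VACUITY ∕ SPECIES GUARDS.  As in `…LaneFamily`: the lane family on the N08 window is NONEMPTY at every odd `L > 1` (`nonempty_laneIndex`) — no empty-family vacuity; the re-bound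
[B10] layer is the LANE's constructed family along the selected inputs (the lane's averaging class with its exact Haar compatibility field), NOT print's run family of record
along `avOfPrint` — NOT an inhabitant of the slot of record `PrintedUV3V`; whether N08's COUNT may be read there is the chair's species word (seam E6′, R451 ∕ R454).  (b11‴) is
a realisability statement about histories inside [7]'s regular class — automatic at the trivial history (dag-n08-d file 12 docstring), displayed, not proved.

WHAT THIS FILE PROVES (0 `def`, 0 `sorry`; kernel bookkeeping BY NAME).
* §1 `exists_inputs_faces₃_family_of_profile` — the selection uniformly in `S : Scales L` (faces form), `exists_inputs_runAlpha_family_of_profile_std` (standard-averaging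
  form: `RunAlpha` from DATA on the window).
* §2 ★ `exists_world₁₃C_laneFamily_b10_main_of_profile` (pointed: a ₁₃C record of `datumOfRecord₁₃ θ h` bound over the lane-re-bound Stage-13 view at the selected inputs,
  any window `γw`, carrying N08 at every run), ★ `exists_guarded_record₁₃C_laneFamily_b10_main_of_profile` (N08's conjunct shape of `NodesAtSomeRecord13`, witnessed AT `θ`);
  §2b ★ `exists_inputs_b10_main_pin3_of_profile` (provisos-free pointed closer over the lane-keyed four-layer word `((((θ.rebindX …).pinY Y₀).pinZ Z₀).pinW W₀).toStage5₁₃` —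
  the `b10` line of a four-pin pointed assembler taking N08 from the (α) programme).
* §3 standard averaging: `b10Compact_laneFamily_of_runAlpha` (the compact node of the re-bound carriers from a `RunAlpha` family on the N08 window — dag-n08-d's
  `b10Compact_constructedLE_at` at `γ := γ_N08`), `exists_world₁₃C_laneFamily_b10_main_of_runAlpha`, `exists_guarded_record₁₃C_laneFamily_b10_main_of_runAlpha`,
  ★ `exists_world₁₃C_laneFamily_b10_main_of_profile_std`, ★ `exists_guarded_record₁₃C_laneFamily_b10_main_of_profile_std`.
* §4 on K0a's all-numerics family at `N = 2`, block size `F.L`, provisos opaque: ★★ `exists_guarded_record₁₃C_laneFamily_b10_main_at_theta13LiveOfNumerics_of_profile`,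
  ★★ `…_of_profile_std`, and the DATA-∧-faces form `…_of_data_faces₃` (the `hP`-opaque twin of `…LaneFamily`'s `_of_bg_numerics_two`).
HONEST FRAMING.  Count-neutral; NOT A DISCHARGE OF N08; nothing of Bałaban's asserted — (b11‴), the kinematic choices, the cluster-expansion DATA schema at the selected
inputs, K0‴'s provisos, the guard and the signs are DISPLAYED hypotheses; the selected inputs are existential; the re-bound [B10] layer is NOT the slot of record; one finite
four-torus per run at fixed `ε`, the lane's d = 3 tori inside the record; nothing continuum ∕ ℝ⁴ ∕ OS ∕ mass gap ∕ Clay.  Filed `--supports` K1‴ `StabilityBAtRecordR13e`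
(stmt-QuantumFields-19910, route rev 16∕17) `--as helper`.
Sources: [Balaban1985UV3] Thm 1 p.257 (compact reading), Thm 2 p.272, (41)–(42) p.266, (67)–(68) p.273, p.256 L15–18; [Balaban1985Variational] Thm 1, (2)+(3)+(8) pp.278–279;
[Balaban1989LargeFieldII] Thm 1 + (0.1) pp.355–356; [Balaban1988Convergent] (2.28) p.259, (3.16)–(3.22) pp.268–269; [Balaban1987RG1] (0.1) p.251, Thm 1 p.255.
-/

noncomputable section

namespace Summit.QuantumFields.YangMills.BalabanUVNodes.N08AtRecord13LaneProfile

open MeasureTheory Set Topology TopologicalSpace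
open scoped Matrix Matrix.Norms.L2Operator
open Literature.MathematicalPhysics.QuantumFieldTheory.Balaban1983to89
open Literature.MathematicalPhysics.QuantumFieldTheory.Balaban1983to89.B10
open Literature.MathematicalPhysics.QuantumFieldTheory.Balaban1983to89.B10SectCExpansion (TermSizes)
open Literature.MathematicalPhysics.QuantumFieldTheory.Balaban1985CMP102
open Literature.MathematicalPhysics.QuantumFieldTheory.Balaban1985CMP102.Setting
open Literature.MathematicalPhysics.QuantumFieldTheory.Balaban1983to89.T4Continuum (T4Family)
open Literature.MathematicalPhysics.QuantumFieldTheory.Balaban1983to89.DagBinding (leavesP WorldP PrintedCarriersR PrintedCarriers9X PrintedCarriers11 PrintedCarriers15)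
open Literature.MathematicalPhysics.QuantumFieldTheory.Balaban1983to89.DagDischarged (b10Compact)
open Literature.MathematicalPhysics.QuantumFieldTheory.Balaban1983to89.Node00
open Summit.QuantumFields.Balaban3D.Carriers
open Summit.QuantumFields.Balaban3D.Proofs.Inputs
open Summit.QuantumFields.Balaban3D.Proofs.Primitives (AlphaConsts)
open Summit.QuantumFields.Balaban3D.Proofs.GroupModelLieC (lieC)
open Summit.QuantumFields.Balaban3D.Proofs.UVStability3DInputs
open Summit.QuantumFields.Balaban3D.Proofs.FamilyLE (ScalesLE)
open Summit.QuantumFields.Balaban3D.Proofs.LiftBridge (liftCfg)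
open Summit.QuantumFields.YangMills.Theorems.BalabanUVNodesN08AlphaClassI
open Summit.QuantumFields.YangMills.Theorems.BalabanUVNodesN08AlphaLoop28
open Summit.QuantumFields.YangMills.Theorems.BalabanUVNodesN08AlphaThreeFaces
open Summit.QuantumFields.YangMills.Theorems.BalabanUVNodesN08AlphaGroupTopology
open Summit.QuantumFields.YangMills.Theorems.BalabanUVNodesN08AlphaRegSel
open Summit.QuantumFields.YangMills.Theorems.BalabanUVNodesN08AlphaCompactSel
open Summit.QuantumFields.YangMills.Theorems.BalabanUVNodesN08AlphaArgClass
open Summit.QuantumFields.YangMills.Theorems.BalabanUVNodesN08AlphaProfile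
open Summit.QuantumFields.YangMills.BalabanUVNodes.N08AtRecord13LaneFamily
open B7Prop2Explicit (avgIter)

variable {F : T4Family} {N : ℕ} [NeZero N]
variable {G : Type} [GaugeGroup G] [MeasurableSpace G] [HaarData G]

/-! ## §1 THE SELECTION, UNIFORMLY IN `S : Scales L` — external inputs with the three in-edge faces (resp. with `RunAlpha` from DATA) from regular `h`-large profiles (b11‴)
on the N08 window `g²ε₀ ≤ (min γ_N08 1)²`; off the window the proof keeps the base inputs (the statements record only the agreement on `av ∕ reg`) -/

section Selection
variable {L : ℕ} (𝔊 : GroupModel G) (𝔠 : AlphaConsts L 𝔊.N)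

/-- **SELECTED EXTERNAL INPUTS WITH THE THREE IN-EDGE FACES, UNIFORMLY IN `S`** (dag-n08-d's `exists_externalInputs_faces₃_of_profile` at print's single regularity constant
`regMin 𝔠`, one lattice approximation at a time, assembled by the axiom of choice; off the N08 window the witness is `X₀ S`).  Hypotheses per `S` on the window: a continuous objective
`A S`, profiles `W S k h ∈ regClassC ∩ argClassC` with `h`-large lifted averages ((b11‴), DISPLAYED), top maps `T S k` continuous on [7]'s class, bonds `Bk S`.
[cite: Balaban1985UV3, (42) p.266 + (67)–(68) p.273; Balaban1985Variational, Thm 1, (2)+(3)+(8) pp.278–279 (kinematic reading)] -/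
theorem exists_inputs_faces₃_family_of_profile (X₀ : ∀ S : Scales L, ExternalInputs S G) {A : ∀ S : Scales L, GaugeField S.P 0 G → ℝ}
    (hA : letI := rhoTopology 𝔊; ∀ S : Scales L, Continuous (A S)) (W : ∀ (S : Scales L) (k : ℕ), Hist S.P k → GaugeField S.P 0 G)
    (hW : ∀ S : Scales L, S.g ^ 2 * S.ε₀ ≤ (min (gammaN08 𝔠) 1) ^ 2 → ∀ k, k ≤ S.K → ∀ (h : Hist S.P k),
      Hist.Admissible (regMin 𝔠).lane.carrier.M₁ (rcolOf S (regMin 𝔠).lane.carrier) k h → W S k h ∈ regClassC 𝔊 (regMin 𝔠) k h ∩ argClassC 𝔊 k)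
    (hWL : ∀ S : Scales L, S.g ^ 2 * S.ε₀ ≤ (min (gammaN08 𝔠) 1) ^ 2 → ∀ (k : ℕ) (h : Hist S.P k),
      HLarge S (regMin 𝔠).lane.carrier.b₀ (regMin 𝔠).lane.carrier.p₀ h (fun j => avgIter L (liftCfg 𝔊 (W S k h)) j))
    (T : ∀ (S : Scales L) (k : ℕ), GaugeField S.P 0 G → GaugeField S.P k G) (Bk : ∀ (S : Scales L) (k : ℕ), Hist S.P k → Set (PBond S.P k))
    (hT : letI := rhoTopology 𝔊; ∀ (S : Scales L) (k : ℕ) (h : Hist S.P k), ContinuousOn (T S k) (regClass 𝔊 (regMin 𝔠) k h)) :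
    ∃ X : ∀ S : Scales L, ExternalInputs S G, ∀ S : Scales L, (X S).av = (X₀ S).av ∧ (X S).reg = (X₀ S).reg ∧
      (S.g ^ 2 * S.ε₀ ≤ (min (gammaN08 𝔠) 1) ^ 2 →
        (∀ (k : ℕ) (h : Hist S.P k), Measurable ((X S).UkH k h)) ∧ InEdgeFaces₃ 𝔊 (regMin 𝔠) (X S)) := by
  have key : ∀ S : Scales L, ∃ X : ExternalInputs S G, X.av = (X₀ S).av ∧ X.reg = (X₀ S).reg ∧
      (S.g ^ 2 * S.ε₀ ≤ (min (gammaN08 𝔠) 1) ^ 2 → (∀ (k : ℕ) (h : Hist S.P k), Measurable (X.UkH k h)) ∧ InEdgeFaces₃ 𝔊 (regMin 𝔠) X) := by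
    intro S
    by_cases hS : S.g ^ 2 * S.ε₀ ≤ (min (gammaN08 𝔠) 1) ^ 2
    · obtain ⟨X, hav, hreg, hm, hF⟩ :=
        exists_externalInputs_faces₃_of_profile 𝔊 (regMin 𝔠) (X₀ S) (hA S) (W S) (hW S hS) (hWL S hS) (T S) (Bk S) (hT S)
      exact ⟨X, hav, hreg, fun _ => ⟨hm, hF⟩⟩
    · exact ⟨X₀ S, rfl, rfl, fun h => absurd h hS⟩
  choose X hX using key
  exact ⟨X, hX⟩

/-- **SELECTED EXTERNAL INPUTS WITH `RunAlpha` FROM THE DATA SCHEMA ON THE N08 WINDOW, UNIFORMLY IN `S` — standard averaging, objective a Wilson action of weight `w`, top map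
the iterated standard averaging** (dag-n08-d's `exists_externalInputs_runAlpha_of_profile`, assembled by the axiom of choice; off the window the witness is `X₀ S`).  Hypotheses per `S`
on the window: profiles (b11‴) and bonds only. [cite: Balaban1985UV3, (41)–(42) p.266 + (67)–(68) p.273; Balaban1985Variational, Thm 1 (8) p.279 (kinematic reading)] -/
theorem exists_inputs_runAlpha_family_of_profile_std (X₀ : ∀ S : Scales L, ExternalInputs S G)
    (hstd : ∀ S : Scales L, (X₀ S).av = AveragingRT.stdAvg S.P G) (w : ℝ) (W : ∀ (S : Scales L) (k : ℕ), Hist S.P k → GaugeField S.P 0 G)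
    (hW : ∀ S : Scales L, S.g ^ 2 * S.ε₀ ≤ (min (gammaN08 𝔠) 1) ^ 2 → ∀ k, k ≤ S.K → ∀ (h : Hist S.P k),
      Hist.Admissible (regMin 𝔠).lane.carrier.M₁ (rcolOf S (regMin 𝔠).lane.carrier) k h → W S k h ∈ regClassC 𝔊 (regMin 𝔠) k h ∩ argClassC 𝔊 k)
    (hWL : ∀ S : Scales L, S.g ^ 2 * S.ε₀ ≤ (min (gammaN08 𝔠) 1) ^ 2 → ∀ (k : ℕ) (h : Hist S.P k),
      HLarge S (regMin 𝔠).lane.carrier.b₀ (regMin 𝔠).lane.carrier.p₀ h (fun j => avgIter L (liftCfg 𝔊 (W S k h)) j))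
    (Bk : ∀ (S : Scales L) (k : ℕ), Hist S.P k → Set (PBond S.P k)) :
    ∃ X : ∀ S : Scales L, ExternalInputs S G, ∀ S : Scales L, (X S).av = (X₀ S).av ∧ (X S).reg = (X₀ S).reg ∧
      (S.g ^ 2 * S.ε₀ ≤ (min (gammaN08 𝔠) 1) ^ 2 →
        (∀ (k : ℕ) (h : Hist S.P k), Measurable ((X S).UkH k h)) ∧ InEdgeFaces₃ 𝔊 (regMin 𝔠) (X S) ∧
        ∀ (𝔖 : ∀ k, StepSeries S G ↥(lieC 𝔊) (nblkOf S 𝔠.lane.carrier k) k) (𝔄 : AlphaData 𝔊 𝔠 (X S) 𝔖)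
          (coef : (k : ℕ) → Hist S.P (k + 1) → GaugeField S.P (k + 1) G → (j : ℕ) → TermSizes (oldGeom S.P k j)),
          RunDataRows 𝔊 𝔠 (X S) 𝔖 𝔄 (sizesOf 𝔊 𝔠 (X S) coef) → RunAlpha 𝔊 𝔠 (X S) 𝔖 𝔄) := by
  have key : ∀ S : Scales L, ∃ X : ExternalInputs S G, X.av = (X₀ S).av ∧ X.reg = (X₀ S).reg ∧
      (S.g ^ 2 * S.ε₀ ≤ (min (gammaN08 𝔠) 1) ^ 2 →
        (∀ (k : ℕ) (h : Hist S.P k), Measurable (X.UkH k h)) ∧ InEdgeFaces₃ 𝔊 (regMin 𝔠) X ∧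
        ∀ (𝔖 : ∀ k, StepSeries S G ↥(lieC 𝔊) (nblkOf S 𝔠.lane.carrier k) k) (𝔄 : AlphaData 𝔊 𝔠 X 𝔖)
          (coef : (k : ℕ) → Hist S.P (k + 1) → GaugeField S.P (k + 1) G → (j : ℕ) → TermSizes (oldGeom S.P k j)),
          RunDataRows 𝔊 𝔠 X 𝔖 𝔄 (sizesOf 𝔊 𝔠 X coef) → RunAlpha 𝔊 𝔠 X 𝔖 𝔄) := by
    intro S
    by_cases hS : S.g ^ 2 * S.ε₀ ≤ (min (gammaN08 𝔠) 1) ^ 2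
    · obtain ⟨X, hav, hreg, hm, hF, hα⟩ := exists_externalInputs_runAlpha_of_profile 𝔊 𝔠 (X₀ S) (hstd S) w (W S) (hW S hS) (hWL S hS) (Bk S)
      exact ⟨X, hav.trans (hstd S).symm, hreg, fun _ => ⟨hm, hF, fun 𝔖 𝔄 coef hD => hα 𝔖 𝔄 coef hS hD⟩⟩
    · exact ⟨X₀ S, rfl, rfl, fun h => absurd h hS⟩
  choose X hX using key
  exact ⟨X, hX⟩

end Selection

/-! ## §2 N08 AT THE LANE-RE-BOUND ₁₃C RECORD FROM PROFILES (b11‴) + DATA AT THE SELECTED INPUTS — objective and top maps free (`θ` generic, block size `θ.L`) -/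

section Profile
variable {𝔊 : GroupModel G} (θ : Stage13Params F N) (h : θ.Provisos₁₃ F N) (hθ : θ.Admissible F N) {𝔠 : AlphaConsts θ.L 𝔊.N}
  (X₀ : ∀ S : Scales θ.L, ExternalInputs S G) {A : ∀ S : Scales θ.L, GaugeField S.P 0 G → ℝ}
  (hA : letI := rhoTopology 𝔊; ∀ S : Scales θ.L, Continuous (A S)) (W : ∀ (S : Scales θ.L) (k : ℕ), Hist S.P k → GaugeField S.P 0 G)
  (hW : ∀ S : Scales θ.L, S.g ^ 2 * S.ε₀ ≤ (min (gammaN08 𝔠) 1) ^ 2 → ∀ k, k ≤ S.K → ∀ (h : Hist S.P k),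
    Hist.Admissible (regMin 𝔠).lane.carrier.M₁ (rcolOf S (regMin 𝔠).lane.carrier) k h → W S k h ∈ regClassC 𝔊 (regMin 𝔠) k h ∩ argClassC 𝔊 k)
  (hWL : ∀ S : Scales θ.L, S.g ^ 2 * S.ε₀ ≤ (min (gammaN08 𝔠) 1) ^ 2 → ∀ (k : ℕ) (h : Hist S.P k),
    HLarge S (regMin 𝔠).lane.carrier.b₀ (regMin 𝔠).lane.carrier.p₀ h (fun j => avgIter θ.L (liftCfg 𝔊 (W S k h)) j))
  (T : ∀ (S : Scales θ.L) (k : ℕ), GaugeField S.P 0 G → GaugeField S.P k G) (Bk : ∀ (S : Scales θ.L) (k : ℕ), Hist S.P k → Set (PBond S.P k))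
  (hT : letI := rhoTopology 𝔊; ∀ (S : Scales θ.L) (k : ℕ) (h : Hist S.P k), ContinuousOn (T S k) (regClass 𝔊 (regMin 𝔠) k h))

include h hθ hA hW hWL Bk hT

/-- **★ POINTED: A ₁₃C RECORD OF `datumOfRecord₁₃ F N θ h` BOUND OVER THE LANE-RE-BOUND STAGE-13 VIEW AT THE SELECTED INPUTS, CARRYING N08 AT EVERY RUN, from profiles (b11‴)
and the DATA schema at the selected inputs** (any window `γw`, block size `θ.L`): external inputs `X` (agreeing with `X₀` on `av ∕ reg`; on the N08 window measurable, with the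
three in-edge faces) EXIST such that, for every `𝔖 ∕ 𝔄 ∕ coef` with the DATA schema on the window, some world IS such a record, bound over
`(θ.rebindX (P ↦ (θ.res.X P).withTowerRuns10 (S ↦ towerOf 𝔠.lane (X S) (𝔖 S)))).toStage5₁₃`, with `Dag.B10_main (leavesP w P)` at every run
(`…LaneFamily.exists_world₁₃C_laneFamily_b10_main_of_data_faces₃`, face hypothesis DISCHARGED by dag-n08-d's chain). [cite: Balaban1985UV3, Thm 1 p.257 (compact reading) + Thm 2 p.272 + (42) p.266; Balaban1985Variational, Thm 1 (8) p.279; Balaban1989LargeFieldII, Thm 1 + (0.1) pp.355–356 (bookkeeping)] -/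
theorem exists_world₁₃C_laneFamily_b10_main_of_profile {γw : ℝ} (hγw : 0 < γw ∧ γw ≤ θ.γ) :
    ∃ X : ∀ S : Scales θ.L, ExternalInputs S G,
      (∀ S : Scales θ.L, (X S).av = (X₀ S).av ∧ (X S).reg = (X₀ S).reg ∧
        (S.g ^ 2 * S.ε₀ ≤ (min (gammaN08 𝔠) 1) ^ 2 → (∀ (k : ℕ) (h : Hist S.P k), Measurable ((X S).UkH k h)) ∧ InEdgeFaces₃ 𝔊 (regMin 𝔠) (X S))) ∧
      ∀ (𝔖 : ∀ (S : Scales θ.L) (k : ℕ), StepSeries S G ↥(lieC 𝔊) (nblkOf S 𝔠.lane.carrier k) k) (𝔄 : ∀ S : Scales θ.L, AlphaData 𝔊 𝔠 (X S) (𝔖 S))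
        (coef : ∀ (S : Scales θ.L) (k : ℕ), Hist S.P (k + 1) → GaugeField S.P (k + 1) G → (j : ℕ) → TermSizes (oldGeom S.P k j)),
        (∀ S : Scales θ.L, S.g ^ 2 * S.ε₀ ≤ (min (gammaN08 𝔠) 1) ^ 2 → RunDataRows 𝔊 𝔠 (X S) (𝔖 S) (𝔄 S) (sizesOf 𝔊 𝔠 (X S) (coef S))) →
        ∃ w : WorldP, IsRecordOfRecord₁₃C F N (datumOfRecord₁₃ F N θ h) w ∧ w.γ = γw ∧ w.L = (θ.L : ℝ) ∧
          (∀ P, w.up P = upOfRecord₅C F N ((θ.rebindX F N fun P => (θ.res.X P).withTowerRuns10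
            fun S : ScalesLE θ.L ((min (gammaN08 𝔠) 1) ^ 2) => towerOf 𝔠.lane (X S.1) (𝔖 S.1)).toStage5₁₃ F N) P) ∧
          ∀ P : B12.RunParams, Dag.B10_main (leavesP w P) := by
  obtain ⟨X, hX⟩ := exists_inputs_faces₃_family_of_profile 𝔊 𝔠 X₀ hA W hW hWL T Bk hT
  exact ⟨X, hX, fun 𝔖 𝔄 coef hD =>
    exists_world₁₃C_laneFamily_b10_main_of_data_faces₃ θ h hθ (𝔄 := 𝔄) coef hD (fun S hS => ((hX S).2.2 hS).2) hγw⟩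

/-- **★ N08's CONJUNCT SHAPE OF K1‴'s `NodesAtSomeRecord13`, WITNESSED AT `θ`, from profiles (b11‴) and the DATA schema at the selected inputs** (plus `θ`'s provisos,
admissibility and guard; block size `θ.L`): external inputs `X` as in §1 EXIST such that for every `𝔖 ∕ 𝔄 ∕ coef` with the DATA schema on the N08 window,
`∃ θ' h' w, guard ∧ Admissible ∧ IsRecordOfRecord₁₃C F N (datumOfRecord₁₃ F N θ' h') w ∧ ∀ P, Dag.B10_main (leavesP w P)` (`…LaneFamily.exists_guarded_record₁₃C_laneFamily_b10_main_of_data_faces₃`,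
face hypothesis DISCHARGED). [cite: Balaban1985UV3, Thm 1 p.257 (compact reading) + Thm 2 p.272 + (42) p.266; Balaban1985Variational, Thm 1 (8) p.279; Balaban1989LargeFieldII, Thm 1 + (0.1) pp.355–356; Balaban1988Convergent, (3.16)–(3.22) pp.268–269 (bookkeeping)] -/
theorem exists_guarded_record₁₃C_laneFamily_b10_main_of_profile (hG : θ.ZtUnity F N ∧ θ.SlotsNondegenerate₁₃ F N) :
    ∃ X : ∀ S : Scales θ.L, ExternalInputs S G,
      (∀ S : Scales θ.L, (X S).av = (X₀ S).av ∧ (X S).reg = (X₀ S).reg ∧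
        (S.g ^ 2 * S.ε₀ ≤ (min (gammaN08 𝔠) 1) ^ 2 → (∀ (k : ℕ) (h : Hist S.P k), Measurable ((X S).UkH k h)) ∧ InEdgeFaces₃ 𝔊 (regMin 𝔠) (X S))) ∧
      ∀ (𝔖 : ∀ (S : Scales θ.L) (k : ℕ), StepSeries S G ↥(lieC 𝔊) (nblkOf S 𝔠.lane.carrier k) k) (𝔄 : ∀ S : Scales θ.L, AlphaData 𝔊 𝔠 (X S) (𝔖 S))
        (coef : ∀ (S : Scales θ.L) (k : ℕ), Hist S.P (k + 1) → GaugeField S.P (k + 1) G → (j : ℕ) → TermSizes (oldGeom S.P k j)),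
        (∀ S : Scales θ.L, S.g ^ 2 * S.ε₀ ≤ (min (gammaN08 𝔠) 1) ^ 2 → RunDataRows 𝔊 𝔠 (X S) (𝔖 S) (𝔄 S) (sizesOf 𝔊 𝔠 (X S) (coef S))) →
        ∃ (θ' : Stage13Params F N) (h' : θ'.Provisos₁₃ F N) (w : WorldP), (θ'.ZtUnity F N ∧ θ'.SlotsNondegenerate₁₃ F N) ∧ θ'.Admissible F N ∧
          IsRecordOfRecord₁₃C F N (datumOfRecord₁₃ F N θ' h') w ∧ ∀ P : B12.RunParams, Dag.B10_main (leavesP w P) := by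
  obtain ⟨X, hX⟩ := exists_inputs_faces₃_family_of_profile 𝔊 𝔠 X₀ hA W hW hWL T Bk hT
  exact ⟨X, hX, fun 𝔖 𝔄 coef hD =>
    exists_guarded_record₁₃C_laneFamily_b10_main_of_data_faces₃ θ h hθ hG (𝔄 := 𝔄) coef hD fun S hS => ((hX S).2.2 hS).2⟩

end Profile

/-! ## §2b POINTED, OVER THE LANE-KEYED FOUR-LAYER STAGE-13 WORD `((((θ.rebindX (lane family at the selected inputs)).pinY Y₀).pinZ Z₀).pinW W₀).toStage5₁₃` — the `b10` line of a
four-pin pointed assembler that takes N08 from the (α) programme, faces DISCHARGED (provisos-free; `…LaneFamily` §2b `b10_main_of_up_rebindX_towerRuns_pin3` BY NAME) -/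

section Pin3Profile
variable {𝔊 : GroupModel G}

/-- **★ POINTED CLOSER OVER THE LANE-KEYED FOUR-LAYER WORD, from profiles (b11‴) and the DATA schema at the selected inputs**: inputs `X` as in §1 EXIST such that, for every
`𝔖 ∕ 𝔄 ∕ coef` with DATA on the N08 window, at EVERY world bound over `((((θ.rebindX (lane family at X, 𝔖)).pinY Y₀).pinZ Z₀).pinW W₀).toStage5₁₃` (any outer pins), `Dag.B10_main`
holds at every run — no provisos, no record predicate: the `h`-line a lane-keyed four-pin pointed Stage-13 assembler consumes for N08. [cite: Balaban1985UV3, Thm 1 p.257 (compact reading) + Thm 2 p.272 + (42) p.266; Balaban1985Variational, Thm 1 (8) p.279; Balaban1989LargeFieldI, (0.2) p.176 (bookkeeping: the outer pins)] -/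
theorem exists_inputs_b10_main_pin3_of_profile (θ : Stage13Params F N) {𝔠 : AlphaConsts θ.L 𝔊.N}
    (X₀ : ∀ S : Scales θ.L, ExternalInputs S G) {A : ∀ S : Scales θ.L, GaugeField S.P 0 G → ℝ}
    (hA : letI := rhoTopology 𝔊; ∀ S : Scales θ.L, Continuous (A S)) (W : ∀ (S : Scales θ.L) (k : ℕ), Hist S.P k → GaugeField S.P 0 G)
    (hW : ∀ S : Scales θ.L, S.g ^ 2 * S.ε₀ ≤ (min (gammaN08 𝔠) 1) ^ 2 → ∀ k, k ≤ S.K → ∀ (h : Hist S.P k),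
      Hist.Admissible (regMin 𝔠).lane.carrier.M₁ (rcolOf S (regMin 𝔠).lane.carrier) k h → W S k h ∈ regClassC 𝔊 (regMin 𝔠) k h ∩ argClassC 𝔊 k)
    (hWL : ∀ S : Scales θ.L, S.g ^ 2 * S.ε₀ ≤ (min (gammaN08 𝔠) 1) ^ 2 → ∀ (k : ℕ) (h : Hist S.P k),
      HLarge S (regMin 𝔠).lane.carrier.b₀ (regMin 𝔠).lane.carrier.p₀ h (fun j => avgIter θ.L (liftCfg 𝔊 (W S k h)) j))
    (T : ∀ (S : Scales θ.L) (k : ℕ), GaugeField S.P 0 G → GaugeField S.P k G) (Bk : ∀ (S : Scales θ.L) (k : ℕ), Hist S.P k → Set (PBond S.P k))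
    (hT : letI := rhoTopology 𝔊; ∀ (S : Scales θ.L) (k : ℕ) (h : Hist S.P k), ContinuousOn (T S k) (regClass 𝔊 (regMin 𝔠) k h)) :
    ∃ X : ∀ S : Scales θ.L, ExternalInputs S G,
      (∀ S : Scales θ.L, (X S).av = (X₀ S).av ∧ (X S).reg = (X₀ S).reg ∧
        (S.g ^ 2 * S.ε₀ ≤ (min (gammaN08 𝔠) 1) ^ 2 → (∀ (k : ℕ) (h : Hist S.P k), Measurable ((X S).UkH k h)) ∧ InEdgeFaces₃ 𝔊 (regMin 𝔠) (X S))) ∧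
      ∀ (𝔖 : ∀ (S : Scales θ.L) (k : ℕ), StepSeries S G ↥(lieC 𝔊) (nblkOf S 𝔠.lane.carrier k) k) (𝔄 : ∀ S : Scales θ.L, AlphaData 𝔊 𝔠 (X S) (𝔖 S))
        (coef : ∀ (S : Scales θ.L) (k : ℕ), Hist S.P (k + 1) → GaugeField S.P (k + 1) G → (j : ℕ) → TermSizes (oldGeom S.P k j)),
        (∀ S : Scales θ.L, S.g ^ 2 * S.ε₀ ≤ (min (gammaN08 𝔠) 1) ^ 2 → RunDataRows 𝔊 𝔠 (X S) (𝔖 S) (𝔄 S) (sizesOf 𝔊 𝔠 (X S) (coef S))) →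
        ∀ (Y₀ : PrintedCarriers9X) (Z₀ : PrintedCarriers11) (W₀ : B12.RunParams → PrintedCarriers15) {w : WorldP},
          (∀ P, w.up P = upOfRecord₅C F N
            (((((θ.rebindX F N fun P => (θ.res.X P).withTowerRuns10
              fun S : ScalesLE θ.L ((min (gammaN08 𝔠) 1) ^ 2) => towerOf 𝔠.lane (X S.1) (𝔖 S.1)).pinY F N Y₀).pinZ F N Z₀).pinW F N W₀).toStage5₁₃ F N) P) →
          ∀ P : B12.RunParams, Dag.B10_main (leavesP w P) := by
  obtain ⟨X, hX⟩ := exists_inputs_faces₃_family_of_profile 𝔊 𝔠 X₀ hA W hW hWL T Bk hT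
  exact ⟨X, hX, fun 𝔖 𝔄 coef hD Y₀ Z₀ W₀ w hup =>
    b10_main_of_up_rebindX_towerRuns_pin3 (fun P => θ.res.X P) _ Y₀ Z₀ W₀ θ hup
      (b10Compact_laneFamily_of_data_faces₃ θ (𝔄 := 𝔄) coef hD fun S hS => ((hX S).2.2 hS).2)⟩

end Pin3Profile

/-! ## §3 STANDARD AVERAGING: N08 AT THE LANE-RE-BOUND ₁₃C RECORD FROM A `RunAlpha` FAMILY, AND FROM PROFILES (b11‴) + DATA with the Wilson action as objective and the
iterated standard averaging on top (no `A ∕ T ∕ hT`) -/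

section Std
variable {𝔊 : GroupModel G}

/-- **The compact node for `θ`'s carriers with the [B10] layer re-bound to the lane's constructed family on the N08 window, from a `RunAlpha` FAMILY on that window** (dag-n08-d
g3's `b10Compact_constructedLE_at` at `γ := γ_N08 ≤ γ₀`, read at the base carriers `θ.res.X P`). [cite: Balaban1985UV3, Thm 1 p.257 (compact reading) + Thm 2 p.272 + p.256 L15–18] -/
theorem b10Compact_laneFamily_of_runAlpha (θ : Stage13Params F N) {𝔠 : AlphaConsts θ.L 𝔊.N} {X : ∀ S : Scales θ.L, ExternalInputs S G}
    {𝔖 : ∀ (S : Scales θ.L) (k : ℕ), StepSeries S G ↥(lieC 𝔊) (nblkOf S 𝔠.lane.carrier k) k} {𝔄 : ∀ S : Scales θ.L, AlphaData 𝔊 𝔠 (X S) (𝔖 S)}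
    (hα : ∀ S : Scales θ.L, S.g ^ 2 * S.ε₀ ≤ (min (gammaN08 𝔠) 1) ^ 2 → RunAlpha 𝔊 𝔠 (X S) (𝔖 S) (𝔄 S)) (P : B12.RunParams) :
    b10Compact ((θ.res.X P).withTowerRuns10 fun S : ScalesLE θ.L ((min (gammaN08 𝔠) 1) ^ 2) => towerOf 𝔠.lane (X S.1) (𝔖 S.1)).toPrintedCarriers :=
  b10Compact_constructedLE_at (gammaN08_pos 𝔠).le (gammaN08_le_gamma0 𝔠) hα (θ.res.X P)

/-- **POINTED: a ₁₃C record of `datumOfRecord₁₃ F N θ h` bound over the lane-re-bound Stage-13 view, carrying N08 at every run, from a `RunAlpha` family on the N08 window**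
(any window `γw`, block size `θ.L`; `…LaneFamily.exists_world₁₃C_rebindX_towerRuns_b10_main`). [cite: Balaban1985UV3, Thm 1 p.257 (compact reading) + Thm 2 p.272; Balaban1989LargeFieldII, Thm 1 + (0.1) pp.355–356 (bookkeeping)] -/
theorem exists_world₁₃C_laneFamily_b10_main_of_runAlpha {θ : Stage13Params F N} (h : θ.Provisos₁₃ F N) (hθ : θ.Admissible F N)
    {𝔠 : AlphaConsts θ.L 𝔊.N} {X : ∀ S : Scales θ.L, ExternalInputs S G}
    {𝔖 : ∀ (S : Scales θ.L) (k : ℕ), StepSeries S G ↥(lieC 𝔊) (nblkOf S 𝔠.lane.carrier k) k} {𝔄 : ∀ S : Scales θ.L, AlphaData 𝔊 𝔠 (X S) (𝔖 S)}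
    (hα : ∀ S : Scales θ.L, S.g ^ 2 * S.ε₀ ≤ (min (gammaN08 𝔠) 1) ^ 2 → RunAlpha 𝔊 𝔠 (X S) (𝔖 S) (𝔄 S)) {γw : ℝ} (hγw : 0 < γw ∧ γw ≤ θ.γ) :
    ∃ w : WorldP, IsRecordOfRecord₁₃C F N (datumOfRecord₁₃ F N θ h) w ∧ w.γ = γw ∧ w.L = (θ.L : ℝ) ∧
      (∀ P, w.up P = upOfRecord₅C F N ((θ.rebindX F N fun P => (θ.res.X P).withTowerRuns10
        fun S : ScalesLE θ.L ((min (gammaN08 𝔠) 1) ^ 2) => towerOf 𝔠.lane (X S.1) (𝔖 S.1)).toStage5₁₃ F N) P) ∧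
      ∀ P : B12.RunParams, Dag.B10_main (leavesP w P) :=
  exists_world₁₃C_rebindX_towerRuns_b10_main _ _ h hθ hγw (b10Compact_laneFamily_of_runAlpha θ hα)

/-- **N08's conjunct shape of `NodesAtSomeRecord13`, witnessed AT `θ`, from a `RunAlpha` family on the N08 window** (plus provisos, admissibility, guard).
[cite: Balaban1985UV3, Thm 1 p.257 (compact reading) + Thm 2 p.272; Balaban1989LargeFieldII, Thm 1 + (0.1) pp.355–356; Balaban1988Convergent, (3.16)–(3.22) pp.268–269 (bookkeeping)] -/
theorem exists_guarded_record₁₃C_laneFamily_b10_main_of_runAlpha {θ : Stage13Params F N} (h : θ.Provisos₁₃ F N) (hθ : θ.Admissible F N)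
    (hG : θ.ZtUnity F N ∧ θ.SlotsNondegenerate₁₃ F N) {𝔠 : AlphaConsts θ.L 𝔊.N} {X : ∀ S : Scales θ.L, ExternalInputs S G}
    {𝔖 : ∀ (S : Scales θ.L) (k : ℕ), StepSeries S G ↥(lieC 𝔊) (nblkOf S 𝔠.lane.carrier k) k} {𝔄 : ∀ S : Scales θ.L, AlphaData 𝔊 𝔠 (X S) (𝔖 S)}
    (hα : ∀ S : Scales θ.L, S.g ^ 2 * S.ε₀ ≤ (min (gammaN08 𝔠) 1) ^ 2 → RunAlpha 𝔊 𝔠 (X S) (𝔖 S) (𝔄 S)) :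
    ∃ (θ' : Stage13Params F N) (h' : θ'.Provisos₁₃ F N) (w : WorldP), (θ'.ZtUnity F N ∧ θ'.SlotsNondegenerate₁₃ F N) ∧ θ'.Admissible F N ∧
      IsRecordOfRecord₁₃C F N (datumOfRecord₁₃ F N θ' h') w ∧ ∀ P : B12.RunParams, Dag.B10_main (leavesP w P) :=
  exists_guarded_record₁₃C_b10_main_of_towerRuns _ _ h hθ hG (b10Compact_laneFamily_of_runAlpha θ hα)

variable (θ : Stage13Params F N) (h : θ.Provisos₁₃ F N) (hθ : θ.Admissible F N) {𝔠 : AlphaConsts θ.L 𝔊.N}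
  (X₀ : ∀ S : Scales θ.L, ExternalInputs S G) (hstd : ∀ S : Scales θ.L, (X₀ S).av = AveragingRT.stdAvg S.P G) (w : ℝ)
  (W : ∀ (S : Scales θ.L) (k : ℕ), Hist S.P k → GaugeField S.P 0 G)
  (hW : ∀ S : Scales θ.L, S.g ^ 2 * S.ε₀ ≤ (min (gammaN08 𝔠) 1) ^ 2 → ∀ k, k ≤ S.K → ∀ (h : Hist S.P k),
    Hist.Admissible (regMin 𝔠).lane.carrier.M₁ (rcolOf S (regMin 𝔠).lane.carrier) k h → W S k h ∈ regClassC 𝔊 (regMin 𝔠) k h ∩ argClassC 𝔊 k)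
  (hWL : ∀ S : Scales θ.L, S.g ^ 2 * S.ε₀ ≤ (min (gammaN08 𝔠) 1) ^ 2 → ∀ (k : ℕ) (h : Hist S.P k),
    HLarge S (regMin 𝔠).lane.carrier.b₀ (regMin 𝔠).lane.carrier.p₀ h (fun j => avgIter θ.L (liftCfg 𝔊 (W S k h)) j))
  (Bk : ∀ (S : Scales θ.L) (k : ℕ), Hist S.P k → Set (PBond S.P k))

include h hθ hstd w hW hWL Bk

/-- **★ POINTED, STANDARD AVERAGING: a ₁₃C record of `datumOfRecord₁₃ F N θ h` bound over the lane-re-bound Stage-13 view at the selected inputs, carrying N08 at every run,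
from profiles (b11‴) and the DATA schema at the selected inputs** — objective the Wilson action of weight `w`, top map the iterated standard averaging (`X₀ S` standard).
[cite: Balaban1985UV3, Thm 1 p.257 (compact reading) + Thm 2 p.272 + (41)–(42) p.266; Balaban1985Variational, Thm 1 (8) p.279; Balaban1989LargeFieldII, Thm 1 + (0.1) pp.355–356 (bookkeeping)] -/
theorem exists_world₁₃C_laneFamily_b10_main_of_profile_std {γw : ℝ} (hγw : 0 < γw ∧ γw ≤ θ.γ) :
    ∃ X : ∀ S : Scales θ.L, ExternalInputs S G,
      (∀ S : Scales θ.L, (X S).av = (X₀ S).av ∧ (X S).reg = (X₀ S).reg ∧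
        (S.g ^ 2 * S.ε₀ ≤ (min (gammaN08 𝔠) 1) ^ 2 → (∀ (k : ℕ) (h : Hist S.P k), Measurable ((X S).UkH k h)) ∧ InEdgeFaces₃ 𝔊 (regMin 𝔠) (X S))) ∧
      ∀ (𝔖 : ∀ (S : Scales θ.L) (k : ℕ), StepSeries S G ↥(lieC 𝔊) (nblkOf S 𝔠.lane.carrier k) k) (𝔄 : ∀ S : Scales θ.L, AlphaData 𝔊 𝔠 (X S) (𝔖 S))
        (coef : ∀ (S : Scales θ.L) (k : ℕ), Hist S.P (k + 1) → GaugeField S.P (k + 1) G → (j : ℕ) → TermSizes (oldGeom S.P k j)),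
        (∀ S : Scales θ.L, S.g ^ 2 * S.ε₀ ≤ (min (gammaN08 𝔠) 1) ^ 2 → RunDataRows 𝔊 𝔠 (X S) (𝔖 S) (𝔄 S) (sizesOf 𝔊 𝔠 (X S) (coef S))) →
        ∃ w : WorldP, IsRecordOfRecord₁₃C F N (datumOfRecord₁₃ F N θ h) w ∧ w.γ = γw ∧ w.L = (θ.L : ℝ) ∧
          (∀ P, w.up P = upOfRecord₅C F N ((θ.rebindX F N fun P => (θ.res.X P).withTowerRuns10
            fun S : ScalesLE θ.L ((min (gammaN08 𝔠) 1) ^ 2) => towerOf 𝔠.lane (X S.1) (𝔖 S.1)).toStage5₁₃ F N) P) ∧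
          ∀ P : B12.RunParams, Dag.B10_main (leavesP w P) := by
  obtain ⟨X, hX⟩ := exists_inputs_runAlpha_family_of_profile_std 𝔊 𝔠 X₀ hstd w W hW hWL Bk
  exact ⟨X, fun S => ⟨(hX S).1, (hX S).2.1, fun hS => ⟨((hX S).2.2 hS).1, ((hX S).2.2 hS).2.1⟩⟩, fun 𝔖 𝔄 coef hD =>
    exists_world₁₃C_laneFamily_b10_main_of_runAlpha h hθ (𝔄 := 𝔄) (fun S hS => ((hX S).2.2 hS).2.2 (𝔖 S) (𝔄 S) (coef S) (hD S hS)) hγw⟩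

/-- **★ N08's CONJUNCT SHAPE OF `NodesAtSomeRecord13`, WITNESSED AT `θ`, STANDARD AVERAGING, from profiles (b11‴) and the DATA schema at the selected inputs** (plus provisos,
admissibility, guard). [cite: Balaban1985UV3, Thm 1 p.257 (compact reading) + Thm 2 p.272 + (41)–(42) p.266; Balaban1985Variational, Thm 1 (8) p.279; Balaban1989LargeFieldII, Thm 1 + (0.1) pp.355–356; Balaban1988Convergent, (3.16)–(3.22) pp.268–269 (bookkeeping)] -/
theorem exists_guarded_record₁₃C_laneFamily_b10_main_of_profile_std (hG : θ.ZtUnity F N ∧ θ.SlotsNondegenerate₁₃ F N) :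
    ∃ X : ∀ S : Scales θ.L, ExternalInputs S G,
      (∀ S : Scales θ.L, (X S).av = (X₀ S).av ∧ (X S).reg = (X₀ S).reg ∧
        (S.g ^ 2 * S.ε₀ ≤ (min (gammaN08 𝔠) 1) ^ 2 → (∀ (k : ℕ) (h : Hist S.P k), Measurable ((X S).UkH k h)) ∧ InEdgeFaces₃ 𝔊 (regMin 𝔠) (X S))) ∧
      ∀ (𝔖 : ∀ (S : Scales θ.L) (k : ℕ), StepSeries S G ↥(lieC 𝔊) (nblkOf S 𝔠.lane.carrier k) k) (𝔄 : ∀ S : Scales θ.L, AlphaData 𝔊 𝔠 (X S) (𝔖 S))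
        (coef : ∀ (S : Scales θ.L) (k : ℕ), Hist S.P (k + 1) → GaugeField S.P (k + 1) G → (j : ℕ) → TermSizes (oldGeom S.P k j)),
        (∀ S : Scales θ.L, S.g ^ 2 * S.ε₀ ≤ (min (gammaN08 𝔠) 1) ^ 2 → RunDataRows 𝔊 𝔠 (X S) (𝔖 S) (𝔄 S) (sizesOf 𝔊 𝔠 (X S) (coef S))) →
        ∃ (θ' : Stage13Params F N) (h' : θ'.Provisos₁₃ F N) (w : WorldP), (θ'.ZtUnity F N ∧ θ'.SlotsNondegenerate₁₃ F N) ∧ θ'.Admissible F N ∧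
          IsRecordOfRecord₁₃C F N (datumOfRecord₁₃ F N θ' h') w ∧ ∀ P : B12.RunParams, Dag.B10_main (leavesP w P) := by
  obtain ⟨X, hX⟩ := exists_inputs_runAlpha_family_of_profile_std 𝔊 𝔠 X₀ hstd w W hW hWL Bk
  exact ⟨X, fun S => ⟨(hX S).1, (hX S).2.1, fun hS => ⟨((hX S).2.2 hS).1, ((hX S).2.2 hS).2.1⟩⟩, fun 𝔖 𝔄 coef hD =>
    exists_guarded_record₁₃C_laneFamily_b10_main_of_runAlpha h hθ hG (𝔄 := 𝔄) fun S hS => ((hX S).2.2 hS).2.2 (𝔖 S) (𝔄 S) (coef S) (hD S hS)⟩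

end Std

/-! ## §4 ON K0a's ALL-NUMERICS WITNESS FAMILY `θL F n ε₂₉ = theta13LiveOfNumerics F 2 n ε₂₉ …` (`N = 2`, block size `F.L` by `rfl`), PROVISOS OPAQUE `hP : θL.Provisos₁₃ F 2` -/

section Numerics
variable {𝔊 : GroupModel G}

/-- **★★ DATA ∧ FACES form, provisos opaque** (the `hP`-opaque twin of `…LaneFamily.exists_guarded_record₁₃C_laneFamily_b10_main_of_bg_numerics_two`): from `n.Pos`, `0 < ε₂₉`,
`hP : θL.Provisos₁₃ F 2` AT THE MEMBER and lane objects at block size `F.L` with «DATA ∧ three faces» on the N08 window ⟹ N08's conjunct of the ₁₃ nodes-∃ (guard and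
admissibility at `θL` are K0a's theorems BY NAME). [cite: Balaban1985UV3, Thm 1 p.257 (compact reading) + Thm 2 p.272; Balaban1988Convergent, (3.16)–(3.22) pp.268–269; Balaban1987RG1, Thm 1 p.255 (bookkeeping)] -/
theorem exists_guarded_record₁₃C_laneFamily_b10_main_at_theta13LiveOfNumerics_of_data_faces₃ (F : T4Family) {n : Stage12Numerics} {ε₂₉ : ℝ} (hn : n.Pos) (hε' : 0 < ε₂₉)
    (hP : (theta13LiveOfNumerics F 2 n ε₂₉ (zeta316OfRecord F 2 n.ν n.τ9.M n.A₁) (RzOfRecord F 2) (ZtOfRecord F 2)).Provisos₁₃ F 2)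
    {𝔠 : AlphaConsts F.L 𝔊.N} {X : ∀ S : Scales F.L, ExternalInputs S G}
    {𝔖 : ∀ (S : Scales F.L) (k : ℕ), StepSeries S G ↥(lieC 𝔊) (nblkOf S 𝔠.lane.carrier k) k} {𝔄 : ∀ S : Scales F.L, AlphaData 𝔊 𝔠 (X S) (𝔖 S)}
    (coef : ∀ (S : Scales F.L) (k : ℕ), Hist S.P (k + 1) → GaugeField S.P (k + 1) G → (j : ℕ) → TermSizes (oldGeom S.P k j))
    (hD : ∀ S : Scales F.L, S.g ^ 2 * S.ε₀ ≤ (min (gammaN08 𝔠) 1) ^ 2 → RunDataRows 𝔊 𝔠 (X S) (𝔖 S) (𝔄 S) (sizesOf 𝔊 𝔠 (X S) (coef S)))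
    (hF : ∀ S : Scales F.L, S.g ^ 2 * S.ε₀ ≤ (min (gammaN08 𝔠) 1) ^ 2 → InEdgeFaces₃ 𝔊 (regMin 𝔠) (X S)) :
    ∃ (θ : Stage13Params F 2) (h : θ.Provisos₁₃ F 2) (w : WorldP), (θ.ZtUnity F 2 ∧ θ.SlotsNondegenerate₁₃ F 2) ∧ θ.Admissible F 2 ∧
      IsRecordOfRecord₁₃C F 2 (datumOfRecord₁₃ F 2 θ h) w ∧ ∀ P : B12.RunParams, Dag.B10_main (leavesP w P) :=
  exists_guarded_record₁₃C_laneFamily_b10_main_of_data_faces₃ _ hP (admissible_theta13LiveOfNumerics F 2 _ _ _ hn hε')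
    ⟨ztUnity_theta13LiveOfNumerics F 2 n ε₂₉, slotsNondegenerate₁₃_theta13LiveOfNumerics F 2 n ε₂₉ _ _ _ hP⟩ (𝔄 := 𝔄) coef hD hF

/-- **★★ PROFILE form, provisos opaque**: from `n.Pos`, `0 < ε₂₉`, `hP : θL.Provisos₁₃ F 2`, and at block size `F.L` base inputs `X₀`, a continuous objective, profiles (b11‴) with
`h`-large averages, top maps continuous on [7]'s class and bonds on the N08 window ⟹ selected inputs `X` (faces a THEOREM) such that the DATA schema at `X` gives N08's conjunct of
the ₁₃ nodes-∃. [cite: Balaban1985UV3, Thm 1 p.257 (compact reading) + Thm 2 p.272 + (42) p.266; Balaban1985Variational, Thm 1 (8) p.279; Balaban1988Convergent, (3.16)–(3.22) pp.268–269 (bookkeeping)] -/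
theorem exists_guarded_record₁₃C_laneFamily_b10_main_at_theta13LiveOfNumerics_of_profile (F : T4Family) {n : Stage12Numerics} {ε₂₉ : ℝ} (hn : n.Pos) (hε' : 0 < ε₂₉)
    (hP : (theta13LiveOfNumerics F 2 n ε₂₉ (zeta316OfRecord F 2 n.ν n.τ9.M n.A₁) (RzOfRecord F 2) (ZtOfRecord F 2)).Provisos₁₃ F 2)
    {𝔠 : AlphaConsts F.L 𝔊.N}
    (X₀ : ∀ S : Scales F.L, ExternalInputs S G) {A : ∀ S : Scales F.L, GaugeField S.P 0 G → ℝ}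
    (hA : letI := rhoTopology 𝔊; ∀ S : Scales F.L, Continuous (A S)) (W : ∀ (S : Scales F.L) (k : ℕ), Hist S.P k → GaugeField S.P 0 G)
    (hW : ∀ S : Scales F.L, S.g ^ 2 * S.ε₀ ≤ (min (gammaN08 𝔠) 1) ^ 2 → ∀ k, k ≤ S.K → ∀ (h : Hist S.P k),
      Hist.Admissible (regMin 𝔠).lane.carrier.M₁ (rcolOf S (regMin 𝔠).lane.carrier) k h → W S k h ∈ regClassC 𝔊 (regMin 𝔠) k h ∩ argClassC 𝔊 k)
    (hWL : ∀ S : Scales F.L, S.g ^ 2 * S.ε₀ ≤ (min (gammaN08 𝔠) 1) ^ 2 → ∀ (k : ℕ) (h : Hist S.P k),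
      HLarge S (regMin 𝔠).lane.carrier.b₀ (regMin 𝔠).lane.carrier.p₀ h (fun j => avgIter F.L (liftCfg 𝔊 (W S k h)) j))
    (T : ∀ (S : Scales F.L) (k : ℕ), GaugeField S.P 0 G → GaugeField S.P k G) (Bk : ∀ (S : Scales F.L) (k : ℕ), Hist S.P k → Set (PBond S.P k))
    (hT : letI := rhoTopology 𝔊; ∀ (S : Scales F.L) (k : ℕ) (h : Hist S.P k), ContinuousOn (T S k) (regClass 𝔊 (regMin 𝔠) k h)) :
    ∃ X : ∀ S : Scales F.L, ExternalInputs S G,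
      (∀ S : Scales F.L, (X S).av = (X₀ S).av ∧ (X S).reg = (X₀ S).reg ∧
        (S.g ^ 2 * S.ε₀ ≤ (min (gammaN08 𝔠) 1) ^ 2 → (∀ (k : ℕ) (h : Hist S.P k), Measurable ((X S).UkH k h)) ∧ InEdgeFaces₃ 𝔊 (regMin 𝔠) (X S))) ∧
      ∀ (𝔖 : ∀ (S : Scales F.L) (k : ℕ), StepSeries S G ↥(lieC 𝔊) (nblkOf S 𝔠.lane.carrier k) k) (𝔄 : ∀ S : Scales F.L, AlphaData 𝔊 𝔠 (X S) (𝔖 S))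
        (coef : ∀ (S : Scales F.L) (k : ℕ), Hist S.P (k + 1) → GaugeField S.P (k + 1) G → (j : ℕ) → TermSizes (oldGeom S.P k j)),
        (∀ S : Scales F.L, S.g ^ 2 * S.ε₀ ≤ (min (gammaN08 𝔠) 1) ^ 2 → RunDataRows 𝔊 𝔠 (X S) (𝔖 S) (𝔄 S) (sizesOf 𝔊 𝔠 (X S) (coef S))) →
        ∃ (θ : Stage13Params F 2) (h : θ.Provisos₁₃ F 2) (w : WorldP), (θ.ZtUnity F 2 ∧ θ.SlotsNondegenerate₁₃ F 2) ∧ θ.Admissible F 2 ∧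
          IsRecordOfRecord₁₃C F 2 (datumOfRecord₁₃ F 2 θ h) w ∧ ∀ P : B12.RunParams, Dag.B10_main (leavesP w P) :=
  exists_guarded_record₁₃C_laneFamily_b10_main_of_profile _ hP (admissible_theta13LiveOfNumerics F 2 _ _ _ hn hε') X₀ hA W hW hWL T Bk hT
    ⟨ztUnity_theta13LiveOfNumerics F 2 n ε₂₉, slotsNondegenerate₁₃_theta13LiveOfNumerics F 2 n ε₂₉ _ _ _ hP⟩

/-- **★★ PROFILE form, STANDARD AVERAGING, provisos opaque**: the same with the Wilson action of weight `w` as objective and the iterated standard averaging on top (`X₀ S`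
standard; no `A ∕ T ∕ hT`). [cite: Balaban1985UV3, Thm 1 p.257 (compact reading) + Thm 2 p.272 + (41)–(42) p.266; Balaban1985Variational, Thm 1 (8) p.279; Balaban1988Convergent, (3.16)–(3.22) pp.268–269 (bookkeeping)] -/
theorem exists_guarded_record₁₃C_laneFamily_b10_main_at_theta13LiveOfNumerics_of_profile_std (F : T4Family) {n : Stage12Numerics} {ε₂₉ : ℝ} (hn : n.Pos) (hε' : 0 < ε₂₉)
    (hP : (theta13LiveOfNumerics F 2 n ε₂₉ (zeta316OfRecord F 2 n.ν n.τ9.M n.A₁) (RzOfRecord F 2) (ZtOfRecord F 2)).Provisos₁₃ F 2)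
    {𝔠 : AlphaConsts F.L 𝔊.N}
    (X₀ : ∀ S : Scales F.L, ExternalInputs S G) (hstd : ∀ S : Scales F.L, (X₀ S).av = AveragingRT.stdAvg S.P G) (w : ℝ)
    (W : ∀ (S : Scales F.L) (k : ℕ), Hist S.P k → GaugeField S.P 0 G)
    (hW : ∀ S : Scales F.L, S.g ^ 2 * S.ε₀ ≤ (min (gammaN08 𝔠) 1) ^ 2 → ∀ k, k ≤ S.K → ∀ (h : Hist S.P k),
      Hist.Admissible (regMin 𝔠).lane.carrier.M₁ (rcolOf S (regMin 𝔠).lane.carrier) k h → W S k h ∈ regClassC 𝔊 (regMin 𝔠) k h ∩ argClassC 𝔊 k)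
    (hWL : ∀ S : Scales F.L, S.g ^ 2 * S.ε₀ ≤ (min (gammaN08 𝔠) 1) ^ 2 → ∀ (k : ℕ) (h : Hist S.P k),
      HLarge S (regMin 𝔠).lane.carrier.b₀ (regMin 𝔠).lane.carrier.p₀ h (fun j => avgIter F.L (liftCfg 𝔊 (W S k h)) j))
    (Bk : ∀ (S : Scales F.L) (k : ℕ), Hist S.P k → Set (PBond S.P k)) :
    ∃ X : ∀ S : Scales F.L, ExternalInputs S G,
      (∀ S : Scales F.L, (X S).av = (X₀ S).av ∧ (X S).reg = (X₀ S).reg ∧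
        (S.g ^ 2 * S.ε₀ ≤ (min (gammaN08 𝔠) 1) ^ 2 → (∀ (k : ℕ) (h : Hist S.P k), Measurable ((X S).UkH k h)) ∧ InEdgeFaces₃ 𝔊 (regMin 𝔠) (X S))) ∧
      ∀ (𝔖 : ∀ (S : Scales F.L) (k : ℕ), StepSeries S G ↥(lieC 𝔊) (nblkOf S 𝔠.lane.carrier k) k) (𝔄 : ∀ S : Scales F.L, AlphaData 𝔊 𝔠 (X S) (𝔖 S))
        (coef : ∀ (S : Scales F.L) (k : ℕ), Hist S.P (k + 1) → GaugeField S.P (k + 1) G → (j : ℕ) → TermSizes (oldGeom S.P k j)),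
        (∀ S : Scales F.L, S.g ^ 2 * S.ε₀ ≤ (min (gammaN08 𝔠) 1) ^ 2 → RunDataRows 𝔊 𝔠 (X S) (𝔖 S) (𝔄 S) (sizesOf 𝔊 𝔠 (X S) (coef S))) →
        ∃ (θ : Stage13Params F 2) (h : θ.Provisos₁₃ F 2) (w : WorldP), (θ.ZtUnity F 2 ∧ θ.SlotsNondegenerate₁₃ F 2) ∧ θ.Admissible F 2 ∧
          IsRecordOfRecord₁₃C F 2 (datumOfRecord₁₃ F 2 θ h) w ∧ ∀ P : B12.RunParams, Dag.B10_main (leavesP w P) :=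
  exists_guarded_record₁₃C_laneFamily_b10_main_of_profile_std _ hP (admissible_theta13LiveOfNumerics F 2 _ _ _ hn hε') X₀ hstd w W hW hWL Bk
    ⟨ztUnity_theta13LiveOfNumerics F 2 n ε₂₉, slotsNondegenerate₁₃_theta13LiveOfNumerics F 2 n ε₂₉ _ _ _ hP⟩

end Numerics

end Summit.QuantumFields.YangMills.BalabanUVNodes.N08AtRecord13LaneProfile

end
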